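import Summits.QuantumFields.BalabanUV.T4Continuum.Spine.NE4.KingCurrencySummable
import Summits.QuantumFields.BalabanUV.T4Continuum.Spine.NE4.AutonomousSchemeParabolicMemory
import Summits.QuantumFields.BalabanUV.T4Continuum.Spine.NE4.AutonomousSchemeParabolic

/-!
# Spine/NE4/KingCurrencySummableWitness — (R56) capstone: the coupling-sensitive parabolic family of (R55) meets EVERY β-side hypothesis shape of King's AF route
# WITHOUT geometric fading (`KingCurrencySummable.direct_matching_eventually_summable`) while violating NE4 and geometric `FadingMemory`

Cell `pub-balaban-gaps` (YM blitz G2), seat `ne4`, generation 15 (unit `pub-balaban-gaps-ne4-g15`); record `HOME/ne/NE4.md` §5 (R56).  Theorems only (no definitions).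

HONEST FRAMING.  `transBeta` (`AutonomousSchemeParabolicMemory`) is an explicit CARICATURE (the Cayley picture of `w ↦ w + 1 + g`), NOT Bałaban's β-function; the END of (R56) is a
statement about RUNS of the printed recursion (0.20) under hypothesis shapes, and the caricature is not claimed to generate such runs — this file only checks, shape by shape,
that its β-SIDE hypotheses (the n-shift input, the history moduli with their three summability properties, the AF-type lower bound) hold for one family for which NE4
(`not_scaleShiftRate_transBeta`) and geometric fading (`not_fadingMemory_transBeta`) FAIL — so the β-side list of the NINTH menu option (`U2-MINIMAL-INTERFACE.md` v10) is
STRICTLY weaker than NE4's and than the geometric companion (2a).  Nothing of Bałaban's asserted; NE4 NOT IN PRINT ∕ NOT PROVED; spine 0∕9; NOT ℝ⁴, NOT a mass gap, NOT Clay.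
-/

noncomputable section

namespace Summit.QuantumFields.BalabanUV.T4Continuum.Spine.NE4.KingCurrencySummable

open Finset Filter Topology
open Literature.MathematicalPhysics.QuantumFieldTheory.Balaban1983to89
open Literature.MathematicalPhysics.QuantumFieldTheory.Balaban1983to89.FlowStep
open Literature.MathematicalPhysics.QuantumFieldTheory.Balaban1983to89.T4CouplingMatching
open Summit.QuantumFields.BalabanUV.T4Continuum.Spine.NE4.KingCurrency (UniformShift)
open Summit.QuantumFields.BalabanUV.T4Continuum.Spine.NE4.Markov
  (transBeta transBeta_eq sum_box_bounds uniformShift_transBeta histLipschitz_transBeta not_fadingMemory_transBeta not_scaleShiftRate_transBeta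
    tendsto_paraOmega)

/-- **THE AF-TYPE LOWER BOUND HOLDS FOR THE CARICATURE**: `EventualLowerH (1∕3) γ 0 transBeta` — on every box `β_{k+1}(v) = 1 − 2∕(2 + Σ(1+v_i)) ≥ 1 − 2∕(k+3) ≥ 1∕3`. [folklore] -/
theorem eventualLowerH_transBeta (γ : ℝ) : EventualLowerH (1 / 3) γ 0 transBeta := by
  intro k v _ hv
  rw [transBeta_eq hv]
  obtain ⟨h1, -⟩ := sum_box_bounds hv
  have hk : (0 : ℝ) ≤ k := Nat.cast_nonneg k
  have hpos : 0 < 2 + ∑ i : Fin (k + 1), (1 + v i) := by linarith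
  have h3 : 2 / (2 + ∑ i : Fin (k + 1), (1 + v i)) ≤ 2 / 3 := div_le_div_of_nonneg_left (by norm_num) (by norm_num) (by linarith)
  linarith

/-- **THE CARICATURE MEETS EVERY β-SIDE HYPOTHESIS SHAPE OF THE NINTH OPTION** (`direct_matching_eventually_summable`'s `hS`, `hω0`, `hωlim` (= (R54)'s `tendsto_paraOmega`, the same modulus), `hL`, `hΛ0`, `hfwd`, `hmass`, `htail`,
`hTlim`, `hlo`, with `ω_j = 2∕(j+3)`, `Λ k i = 2∕(k+3)²`, `M = 1`, `N = 2`, `T J = 2k₀∕(J+2)` at `k₀ = 0`, `b = 1∕3`) — AND violates NE4 at every geometric rate AND admits no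
geometrically fading moduli (`γ > 0`, `0 ≤ θ < 1`).  So the NINTH option's β-side list is STRICTLY weaker than NE4 and than the geometric companion (2a).  (The window
`M·((k₀+1)γ³ + 2γ∕b) ≤ 1∕2` reads `γ³ + 6γ ≤ 1∕2`, a condition on γ alone.)  HYPOTHESIS-SHAPE bookkeeping about a caricature; nothing of Bałaban's asserted. [folklore] -/
theorem ninth_option_shapes_transBeta {γ θ : ℝ} (hγ : 0 < γ) (hθ0 : 0 ≤ θ) (hθ1 : θ < 1) :
    (UniformShift (fun j => 2 / ((j : ℝ) + 3)) γ transBeta ∧ (∀ j : ℕ, (0 : ℝ) ≤ 2 / ((j : ℝ) + 3)) ∧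
      Tendsto (fun j : ℕ => 2 / ((j : ℝ) + 3)) atTop (𝓝 0) ∧
      HistLipschitz (fun k _ => 2 / ((k : ℝ) + 3) ^ 2) γ transBeta ∧ (∀ k i : ℕ, (0 : ℝ) ≤ 2 / ((k : ℝ) + 3) ^ 2) ∧
      ForwardSum (fun k _ => 2 / ((k : ℝ) + 3) ^ 2) 1 ∧ UVMass (fun k _ => 2 / ((k : ℝ) + 3) ^ 2) 0 2 ∧
      YoungTail (fun k _ => 2 / ((k : ℝ) + 3) ^ 2) 0 (fun J => 2 * ((0 : ℕ) : ℝ) / ((J : ℝ) + 2)) ∧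
      Tendsto (fun J : ℕ => 2 * ((0 : ℕ) : ℝ) / ((J : ℝ) + 2)) atTop (𝓝 0) ∧
      EventualLowerH (1 / 3) γ 0 transBeta) ∧
    (∀ c : ℝ, ¬ ScaleShiftRate c θ γ transBeta) ∧
    (∀ (Λ : ℕ → ℕ → ℝ) (C : ℝ), HistLipschitz Λ γ transBeta → ¬ FadingMemory C θ Λ) :=
  ⟨⟨uniformShift_transBeta γ, fun j => by positivity, tendsto_paraOmega, histLipschitz_transBeta γ, fun k i => by positivity,
    forwardSum_flat, uvMass_flat 0, youngTail_flat 0, tendsto_youngTail_flat 0, eventualLowerH_transBeta γ⟩,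
   fun c => not_scaleShiftRate_transBeta hγ hθ0 hθ1 c,
   fun Λ C hL => not_fadingMemory_transBeta hγ hθ0 hθ1 hL⟩

end Summit.QuantumFields.BalabanUV.T4Continuum.Spine.NE4.KingCurrencySummable

end
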